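import Summits.QuantumFields.BalabanUV.T4Continuum.Support.NE3LocalCrudeRate
import HarnessLib

/-!
# T⁴ programme, node NE3 — the LOCAL half, reading (D), CRUDE fixed-torus route, part 4 (END):
# `LocalRate` BY NAME FOR THE UNIT-CUBE ACTION READINGS OF A SELECTION OF REGULAR MINIMISERS, FROM T-E

NE3 prover lineage P1, gen 18 (cell `pub-balaban`, unit `b2b-balaban-t4-ne3-p1`, row NE3 OWNER; journal NOTE l.10685).

CONTENT (0 def, 0 sorry): §1 nested windows — the `k`-fold blocks `B^k(Y) = (blockSites L)^[k] Y` of a set of unit sites stay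
in the period box (`iterate_blockSites_subset_periodBox`) and have `≤ #Y·(L^k)^d` sites (`card_iterate_blockSites_le`); §2 the
window action of a small field (`fineAction_window_le_of_smallField`) and the trivial level-0 step (`abs_loc_one_sub_loc_zero_le`:
`≤ #Pl·b²`); §3 **`localRate_crude_of_energyRate`** — `T4EtaRateMin.LocalRate` BY NAME, rate `L⁻¹`, for the readings carrier
`minActReadings 4 𝒞 L N dom loc_D` whose local reading is READING (D): `loc_D k V x = A_{B^k({x})}(sel k V)`, the Wilson action
of the SELECTED level-`k` minimiser `sel k V` over the plaquettes based at the level-`k` sites of the unit cube at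
`x ∈ [0,N)^4` — from P2's ROOT `NE3EnergyRate 4 𝒞 L N b (gradConst 4 c) C dom` (T-E) and a selection `sel` of minimisers with
`RegularSup 4 L N b c k (sel k V)` ((H∃) in choice form); §4 `actionRate_mono_rate` and **`ne3Shape_crude_of_actionRate`** —
`T4EtaRateMin.NE3Shape` BY NAME (both readings, honest rate `0 ≤ L⁻¹ < 1`, `L ≥ 2`) from the ACTION half in its landed form
(`ActionRate … C_A (L⁻²)`, any constant — e.g. `MinimalActionThm1Type.actionRate_thm1Type_class` at `d = 4`) and §3.

HONEST FRAMING.  **NE3 is NOT proved**: T-E (`NE3EnergyRate` — leaves ML = B9 Thm 3.3 TYPE, L1∕L2∕L11 printed-TYPE hypotheses of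
roads P2∕P3, asserted for no class but the flat one) and the regular selection of minimisers ((H∃), B11 Thm 1 TYPE) are
HYPOTHESES; the (D) reading here is the crude fixed-torus one (constant `∝ N⁴`, no localisation δ, no (W2)); nothing printed is a
hypothesis of a theorem; no conditional of the cell (`BetaPertH`, (B), (B^μ), G-an2-4); no `def`, no `sorry`, axioms ⊆ {propext,
Classical.choice, Quot.sound}.  Finite T⁴ rung (B)+1 — NOT infinite volume, NOT a mass gap, NOT the Clay problem, NOT summit
progress.  PLACEMENT: `Summits/QuantumFields/BalabanUV/`.  HONEST DEPENDENCY (cell page 1): continuum YM on T⁴ ⇐ BetaPertH ∧ nine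
spine estimates (0/9 proved); BetaPertH ⇐ (D1) ∧ (D4) ∧ CAP+tail; G-an2-4 gates asym, D1 and NE2/3/4.
-/

set_option autoImplicit false

open scoped BigOperators Matrix Matrix.Norms.L2Operator
open NormedSpace Finset

namespace Summit.QuantumFields.BalabanUV.T4Continuum.NE3LocalCrudeEnd

open Literature.MathematicalPhysics.QuantumFieldTheory.Balaban1983to89
open B7Prop1Explicit B7Prop2Explicit MatrixLog UnitaryModel
open T4AveragingDeficitWall hiding Site Plane Plaq Bond
open T4AveragingDeficitWallBoundary (periodBox blockSites_periodBox)
open T4AveragingDeficitNonAbelian (wallConstLoc)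
open AveragingDeficitDualResidual (dualC1 dualC2)
open AveragingDeficitDerivWallProof (wallConst wallConst_nonneg)
open T4EtaRateMin (Readings ActionRate LocalRate NE3Shape)
open MinimalActionLevels (fineAction_nonneg)
open MinimalActionLimit (wt_le_half_norm_sq)
open MinimalActionSandwich MinimalActionRate MinimalActionRefine
open NE3EnergyShapes (NE3EnergyRate dualC1_nonneg dualC2_nonneg)
open NE3LocalCrudeWindow (card_blockSites_le)
open NE3LocalCrudeRate (abs_loc_succ_sub_le_of_energyRate)

noncomputable section

variable {d : ℕ} {n : Type*} [Fintype n] [DecidableEq n] [Nonempty n]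

/-! ## §1 Nested windows: the k-fold blocks of a set of unit sites -/

omit [Fintype n] [DecidableEq n] [Nonempty n] in
/-- `blockSites` is monotone in the set of coarse sites. [folklore] -/
theorem blockSites_mono (L : ℕ) {Y Y' : Finset (Site d)} (h : Y ⊆ Y') : blockSites L Y ⊆ blockSites L Y' := by
  unfold blockSites
  exact Finset.biUnion_subset_biUnion_of_subset_left _ h

omit [Fintype n] [DecidableEq n] [Nonempty n] in
/-- The `k`-fold blocks of a window of the period box `[0,M)^d` lie in the period box `[0, M·L^k)^d` of level `k`
(`blockSites_periodBox`). [folklore] -/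
theorem iterate_blockSites_subset_periodBox {L : ℕ} (hL : 1 ≤ L) {M : ℕ} {Y : Finset (Site d)} (hY : Y ⊆ periodBox M)
    (k : ℕ) : (blockSites L)^[k] Y ⊆ periodBox (M * L ^ k) := by
  induction k with
  | zero => simpa using hY
  | succ k ih =>
    rw [Function.iterate_succ_apply', show M * L ^ (k + 1) = L * (M * L ^ k) by ring, ← blockSites_periodBox L (M * L ^ k) hL]
    exact blockSites_mono L ih

omit [Fintype n] [DecidableEq n] [Nonempty n] in
/-- The `k`-fold blocks of `Y` have at most `#Y·(L^k)^d` sites. [folklore] -/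
theorem card_iterate_blockSites_le (L : ℕ) (Y : Finset (Site d)) (k : ℕ) :
    ((((blockSites L)^[k] Y).card : ℕ) : ℝ) ≤ Y.card * ((L : ℝ) ^ k) ^ d := by
  induction k with
  | zero => simp
  | succ k ih =>
    rw [Function.iterate_succ_apply']
    have h1 := card_blockSites_le (d := d) L ((blockSites L)^[k] Y)
    have h2 : (0 : ℝ) ≤ (L : ℝ) ^ d := by positivity
    calc ((blockSites L ((blockSites L)^[k] Y)).card : ℝ) ≤ (((blockSites L)^[k] Y).card : ℝ) * (L : ℝ) ^ d := h1
      _ ≤ Y.card * ((L : ℝ) ^ k) ^ d * (L : ℝ) ^ d := mul_le_mul_of_nonneg_right ih h2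
      _ = Y.card * ((L : ℝ) ^ (k + 1)) ^ d := by rw [pow_succ, mul_pow]; ring

/-! ## §2 The window action of a small field, and the level-0 step -/

/-- The window action of a `U(N)`-valued small field of radius `r` over the plaquettes based in `Y` is at most
`#Y·#Pl·r²/2` (`wt ≤ ½|W − 1|²`, tree `wt_le_half_norm_sq`). [folklore] -/
theorem fineAction_window_le_of_smallField {U : Site d → Fin d → (Matrix n n ℂ)ˣ} (hU : IsUnitaryCfg U) {r : ℝ}
    (hr : SmallField U r) (Y : Finset (Site d)) :
    fineAction U (Y ×ˢ Finset.univ) ≤ Y.card * Fintype.card (T4AveragingDeficitWall.Plane d) * (r ^ 2 / 2) := by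
  unfold fineAction
  have hpt : ∀ p ∈ Y ×ˢ (Finset.univ : Finset (T4AveragingDeficitWall.Plane d)), wt (fhol U p) ≤ r ^ 2 / 2 := by
    intro p _
    have hu : fhol U p ∈ unitaryUnits (Matrix n n ℂ) := hol_mem_of hU _ _
    refine (wt_le_half_norm_sq hu).trans ?_
    have h1 : ‖((fhol U p : (Matrix n n ℂ)ˣ) : Matrix n n ℂ) - 1‖ ≤ r := hr p.1 p.2.1.1 p.2.1.2 (ne_of_lt p.2.2)
    have h2 : ‖((fhol U p : (Matrix n n ℂ)ˣ) : Matrix n n ℂ) - 1‖ ^ 2 ≤ r ^ 2 := pow_le_pow_left₀ (norm_nonneg _) h1 2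
    linarith
  refine (Finset.sum_le_sum hpt).trans (le_of_eq ?_)
  rw [Finset.sum_const, Finset.card_product, Finset.card_univ, nsmul_eq_mul]
  push_cast
  ring

/-- **The level-0 step of reading (D) is trivial** (`d = 4`): for `U(N)`-valued small fields `U₀` (radius `b`) and `U₁`
(radius `b/L²`, `L ≥ 1`) and a unit site `x`, `|A_{B({x})}(U₁) − A_{{x}}(U₀)| ≤ #Pl·b²` (both window actions are non-negative
and `≤ ½#Pl·b²`: one site with radius `b`, resp. `L⁴` sites with radius `b/L²`). [folklore] -/
theorem abs_loc_one_sub_loc_zero_le {L : ℕ} (hL : 1 ≤ L) {b : ℝ} {U₀ U₁ : Site 4 → Fin 4 → (Matrix n n ℂ)ˣ}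
    (h₀ : IsUnitaryCfg U₀) (hs₀ : SmallField U₀ (b / ((L : ℝ) ^ 0) ^ 2)) (h₁ : IsUnitaryCfg U₁)
    (hs₁ : SmallField U₁ (b / ((L : ℝ) ^ 1) ^ 2)) (x : Site 4) :
    |fineAction U₁ (blockSites L {x} ×ˢ Finset.univ) - fineAction U₀ ({x} ×ˢ Finset.univ)|
      ≤ Fintype.card (T4AveragingDeficitWall.Plane 4) * b ^ 2 := by
  have hL0 : (0 : ℝ) < L := by exact_mod_cast hL
  have hb0 : b / ((L : ℝ) ^ 0) ^ 2 = b := by simp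
  have hA0 := fineAction_nonneg h₀ ({x} ×ˢ (Finset.univ : Finset (T4AveragingDeficitWall.Plane 4)))
  have hA1 := fineAction_nonneg h₁ (blockSites L {x} ×ˢ (Finset.univ : Finset (T4AveragingDeficitWall.Plane 4)))
  have hB0 := fineAction_window_le_of_smallField h₀ hs₀ {x}
  have hB1 := fineAction_window_le_of_smallField h₁ hs₁ (blockSites L {x})
  rw [Finset.card_singleton, Nat.cast_one, one_mul, hb0] at hB0
  have hc := card_blockSites_le (d := 4) L ({x} : Finset (Site 4))
  rw [Finset.card_singleton, Nat.cast_one, one_mul] at hc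
  have hP : (0 : ℝ) ≤ Fintype.card (T4AveragingDeficitWall.Plane 4) := by positivity
  have hr : (L : ℝ) ^ 4 * ((b / ((L : ℝ) ^ 1) ^ 2) ^ 2 / 2) = b ^ 2 / 2 := by
    field_simp
  have hB1' : fineAction U₁ (blockSites L {x} ×ˢ Finset.univ)
      ≤ Fintype.card (T4AveragingDeficitWall.Plane 4) * (b ^ 2 / 2) := by
    refine hB1.trans ?_
    have h2 := mul_le_mul_of_nonneg_right hc (by positivity : (0 : ℝ) ≤ (b / ((L : ℝ) ^ 1) ^ 2) ^ 2 / 2)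
    rw [hr] at h2
    calc ((blockSites L {x}).card : ℝ) * Fintype.card (T4AveragingDeficitWall.Plane 4) * ((b / ((L : ℝ) ^ 1) ^ 2) ^ 2 / 2)
        = Fintype.card (T4AveragingDeficitWall.Plane 4) * (((blockSites L {x}).card : ℝ) * ((b / ((L : ℝ) ^ 1) ^ 2) ^ 2 / 2)) := by
          ring
      _ ≤ Fintype.card (T4AveragingDeficitWall.Plane 4) * (b ^ 2 / 2) := mul_le_mul_of_nonneg_left h2 hP
  rw [abs_le]
  constructor <;> nlinarith [hA0, hA1, hB0, hB1']

/-! ## §3 `LocalRate` by name for reading (D), crude fixed-torus constant -/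

/-- **NE3, LOCAL HALF, READING (D) — `T4EtaRateMin.LocalRate` BY NAME, CRUDE FIXED-TORUS ROUTE** (`d = 4`, rate `L⁻¹`).
Let `L, N ≥ 1`, `0 ≤ b, c, C`, `20480·L²·b ≤ 1`; assume P2's ROOT `NE3EnergyRate 4 𝒞 L N b (gradConst 4 c) C dom` (T-E, a
typed HYPOTHESIS) and a SELECTION `sel k V` of run-`k` minimisers of every datum `V ∈ dom` with sup-form regularity
`RegularSup 4 L N b c k (sel k V)` ((H∃) = B11 Thm 1 TYPE, in choice form).  Then the readings carrier `minActReadings 4 𝒞 L N dom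
loc_D` with the LOCAL READING (D) `loc_D k V x = A_{B^k({x})}(sel k V)` — the Wilson action of the selected level-`k` minimiser
over the plaquettes based at the `L^{4k}` level-`k` sites of the unit cube at `x ∈ [0,N)^4` — satisfies
`LocalRate (minActReadings 4 𝒞 L N dom loc_D) K_D (L⁻¹)`:  `|loc_D (k+1) V x − loc_D k V x| ≤ K_D·(L⁻¹)^k` for all `k`, `V`, `x`,
`K_D = wallConstLoc·(2500L³·#Pl·(bc + c²) + b³) + (b + 23142400b²)·√#Pl·R + 14·#Pl·R² + #Pl·b²`,
`R = C·wallConst·N²·(√(gradConst 4 c)·dualC2 + 2b²·dualC1)` (crude: `∝ N⁴`; no localisation δ, no (W2)).  NE3 is NOT proved: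
T-E and (H∃) are the hypotheses. [folklore] -/
theorem localRate_crude_of_energyRate {𝒞 : ℕ → Set (Site 4 → Fin 4 → (Matrix n n ℂ)ˣ)} {L N : ℕ} (hL : 1 ≤ L)
    (hN : 1 ≤ N) {b c C : ℝ} (hb : 0 ≤ b) (hc : 0 ≤ c) (hC : 0 ≤ C) (hbs : 20480 * (L : ℝ) ^ 2 * b ≤ 1)
    {dom : Set (Site 4 → Fin 4 → (Matrix n n ℂ)ˣ)} (hTE : NE3EnergyRate 4 𝒞 L N b (gradConst 4 c) C dom)
    {sel : ℕ → (Site 4 → Fin 4 → (Matrix n n ℂ)ˣ) → (Site 4 → Fin 4 → (Matrix n n ℂ)ˣ)}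
    (hmin : ∀ V ∈ dom, ∀ k, IsMinimiser 4 𝒞 L N k V (sel k V))
    (hreg : ∀ V ∈ dom, ∀ k, RegularSup 4 L N b c k (sel k V)) :
    LocalRate
      (minActReadings 4 𝒞 L N dom
        (fun k V (x : ↥(periodBox (d := 4) N)) =>
          fineAction (sel k V) (((blockSites L)^[k] {(x : Site 4)}) ×ˢ Finset.univ)))
      (wallConstLoc 4 L * (2500 * (L : ℝ) ^ 3 * Fintype.card (T4AveragingDeficitWall.Plane 4) * (b * c + c ^ 2) + b ^ 3)
          + ((b + 23142400 * b ^ 2) * Real.sqrt (Fintype.card (T4AveragingDeficitWall.Plane 4))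
              * (C * (wallConst 4 L * (N : ℝ) ^ 2 * (Real.sqrt (gradConst 4 c) * dualC2 4 L + 2 * b ^ 2 * dualC1 4 L)))
            + 14 * Fintype.card (T4AveragingDeficitWall.Plane 4)
              * (C * (wallConst 4 L * (N : ℝ) ^ 2 * (Real.sqrt (gradConst 4 c) * dualC2 4 L + 2 * b ^ 2 * dualC1 4 L))) ^ 2)
        + Fintype.card (T4AveragingDeficitWall.Plane 4) * b ^ 2)
      ((L : ℝ)⁻¹) := by
  -- the constant is non-negative
  set R : ℝ := C * (wallConst 4 L * (N : ℝ) ^ 2 * (Real.sqrt (gradConst 4 c) * dualC2 4 L + 2 * b ^ 2 * dualC1 4 L))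
    with hRdef
  have hR : 0 ≤ R := by
    have := wallConst_nonneg 4 L
    have := dualC1_nonneg 4 L
    have := dualC2_nonneg 4 L
    positivity
  have hwl : 0 ≤ wallConstLoc 4 L := by
    unfold T4AveragingDeficitNonAbelian.wallConstLoc
    have := T4AveragingDeficitNonAbelian.wallConstNA_nonneg (d := 4) L
    positivity
  set K₁ : ℝ := wallConstLoc 4 L
      * (2500 * (L : ℝ) ^ 3 * Fintype.card (T4AveragingDeficitWall.Plane 4) * (b * c + c ^ 2) + b ^ 3)
    + ((b + 23142400 * b ^ 2) * Real.sqrt (Fintype.card (T4AveragingDeficitWall.Plane 4)) * R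
      + 14 * Fintype.card (T4AveragingDeficitWall.Plane 4) * R ^ 2) with hK₁def
  have hK₁ : 0 ≤ K₁ := by positivity
  have hL0 : (0 : ℝ) < L := by exact_mod_cast (show 0 < L by omega)
  have hθ0 : 0 ≤ ((L : ℝ)⁻¹) := by positivity
  intro k V hV x
  have hV' : V ∈ dom := hV
  obtain ⟨x, hx⟩ := x
  change |fineAction (sel (k + 1) V) (((blockSites L)^[k + 1] {x}) ×ˢ Finset.univ)
      - fineAction (sel k V) (((blockSites L)^[k] {x}) ×ˢ Finset.univ)|
    ≤ (K₁ + Fintype.card (T4AveragingDeficitWall.Plane 4) * b ^ 2) * ((L : ℝ)⁻¹) ^ k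
  rcases k with _ | j
  · -- the level-0 step is trivial
    simp only [zero_add, Function.iterate_one, Function.iterate_zero_apply, pow_zero, mul_one]
    refine (abs_loc_one_sub_loc_zero_le hL (hreg V hV' 0).unitary (hreg V hV' 0).small (hreg V hV' 1).unitary
      (hreg V hV' 1).small x).trans ?_
    linarith
  · -- levels `j+1 → j+2`: part 3 on the window `B^{j+1}({x})`
    have hxN : ({x} : Finset (Site 4)) ⊆ periodBox N := Finset.singleton_subset_iff.mpr hx
    have hY := iterate_blockSites_subset_periodBox (d := 4) hL hxN (j + 1)
    have hYc : ((((blockSites L)^[j + 1] {x}).card : ℕ) : ℝ) ≤ 1 * ((L : ℝ) ^ (j + 1)) ^ 4 := by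
      have := card_iterate_blockSites_le (d := 4) L ({x} : Finset (Site 4)) (j + 1)
      rwa [Finset.card_singleton, Nat.cast_one] at this
    have h := abs_loc_succ_sub_le_of_energyRate hL hN hb hc hC zero_le_one hbs hTE hV' (by omega : 1 ≤ j + 1)
      (hmin V hV' (j + 1)) (hmin V hV' (j + 1 + 1)) (hreg V hV' (j + 1 + 1)) hY hYc
    simp only [mul_one, one_mul] at h
    rw [Function.iterate_succ_apply' (blockSites L) (j + 1) {x}, abs_sub_comm]
    refine h.trans ?_
    have h0 : 0 ≤ Fintype.card (T4AveragingDeficitWall.Plane 4) * b ^ 2 * ((L : ℝ)⁻¹) ^ (j + 1) := by positivity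
    rw [add_mul]
    linarith

/-! ## §4 Both readings: `NE3Shape` by name from the landed action half and §3 -/

omit [Fintype n] [DecidableEq n] [Nonempty n] in
/-- `ActionRate` is monotone in the constant and in the rate. [folklore] -/
theorem actionRate_mono_rate {ι X : Type*} {R : Readings ι X} {C C' θ θ' : ℝ} (h : ActionRate R C θ) (hC : C ≤ C')
    (hC0 : 0 ≤ C) (hθ0 : 0 ≤ θ) (hθ : θ ≤ θ') : ActionRate R C' θ' := by
  intro k V hV
  refine (h k V hV).trans ?_
  have h1 : C * θ ^ k ≤ C' * θ' ^ k :=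
    mul_le_mul hC (pow_le_pow_left₀ hθ0 hθ k) (pow_nonneg hθ0 k) (hC0.trans hC)
  exact mul_le_mul_of_nonneg_right h1 R.vol_nonneg

/-- **NE3 BY NAME ON THE FIXED TORUS, BOTH READINGS, CRUDE (D) — MODULO THE ACTION HALF, T-E AND (H∃)**: for `L ≥ 2`, if the
ACTION half holds in its landed form `ActionRate (minActReadings 4 𝒞 L N dom loc_D) C_A (L⁻²)` with `0 ≤ C_A` (e.g.
`MinimalActionThm1Type.actionRate_thm1Type_class` at `d = 4`, which holds for EVERY local reading, in particular `loc_D`), and the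
hypotheses of §3 hold (T-E + a regular selection of minimisers), then
`NE3Shape (minActReadings 4 𝒞 L N dom loc_D) (max C_A K_D) (L⁻¹)` — `T4EtaRateMin.NE3Shape` BY NAME with the honest rate
`0 ≤ L⁻¹ < 1`.  NE3 is NOT proved: the action half's (H∃), T-E and the selection are hypotheses; (D) is the crude reading. [folklore] -/
theorem ne3Shape_crude_of_actionRate {𝒞 : ℕ → Set (Site 4 → Fin 4 → (Matrix n n ℂ)ˣ)} {L N : ℕ} (hL : 2 ≤ L)
    (hN : 1 ≤ N) {b c C : ℝ} (hb : 0 ≤ b) (hc : 0 ≤ c) (hC : 0 ≤ C) (hbs : 20480 * (L : ℝ) ^ 2 * b ≤ 1)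
    {dom : Set (Site 4 → Fin 4 → (Matrix n n ℂ)ˣ)} (hTE : NE3EnergyRate 4 𝒞 L N b (gradConst 4 c) C dom)
    {sel : ℕ → (Site 4 → Fin 4 → (Matrix n n ℂ)ˣ) → (Site 4 → Fin 4 → (Matrix n n ℂ)ˣ)}
    (hmin : ∀ V ∈ dom, ∀ k, IsMinimiser 4 𝒞 L N k V (sel k V))
    (hreg : ∀ V ∈ dom, ∀ k, RegularSup 4 L N b c k (sel k V)) {C_A : ℝ} (hCA : 0 ≤ C_A)
    (hA : ActionRate
      (minActReadings 4 𝒞 L N dom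
        (fun k V (x : ↥(periodBox (d := 4) N)) =>
          fineAction (sel k V) (((blockSites L)^[k] {(x : Site 4)}) ×ˢ Finset.univ)))
      C_A (((L : ℝ) ^ 2)⁻¹)) :
    NE3Shape
      (minActReadings 4 𝒞 L N dom
        (fun k V (x : ↥(periodBox (d := 4) N)) =>
          fineAction (sel k V) (((blockSites L)^[k] {(x : Site 4)}) ×ˢ Finset.univ)))
      (max C_A
        (wallConstLoc 4 L * (2500 * (L : ℝ) ^ 3 * Fintype.card (T4AveragingDeficitWall.Plane 4) * (b * c + c ^ 2) + b ^ 3)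
          + ((b + 23142400 * b ^ 2) * Real.sqrt (Fintype.card (T4AveragingDeficitWall.Plane 4))
              * (C * (wallConst 4 L * (N : ℝ) ^ 2 * (Real.sqrt (gradConst 4 c) * dualC2 4 L + 2 * b ^ 2 * dualC1 4 L)))
            + 14 * Fintype.card (T4AveragingDeficitWall.Plane 4)
              * (C * (wallConst 4 L * (N : ℝ) ^ 2 * (Real.sqrt (gradConst 4 c) * dualC2 4 L + 2 * b ^ 2 * dualC1 4 L))) ^ 2)
        + Fintype.card (T4AveragingDeficitWall.Plane 4) * b ^ 2))
      ((L : ℝ)⁻¹) := by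
  have hL1 : 1 ≤ L := le_trans (by norm_num) hL
  have hL2 : (2 : ℝ) ≤ L := by exact_mod_cast hL
  have hL0 : (0 : ℝ) < L := by linarith
  have hθ0 : 0 ≤ ((L : ℝ)⁻¹) := by positivity
  have hθθ : ((L : ℝ) ^ 2)⁻¹ ≤ (L : ℝ)⁻¹ := inv_anti₀ hL0 (by nlinarith)
  have hloc := localRate_crude_of_energyRate hL1 hN hb hc hC hbs hTE hmin hreg
  have hK : 0 ≤ wallConstLoc 4 L
          * (2500 * (L : ℝ) ^ 3 * Fintype.card (T4AveragingDeficitWall.Plane 4) * (b * c + c ^ 2) + b ^ 3)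
        + ((b + 23142400 * b ^ 2) * Real.sqrt (Fintype.card (T4AveragingDeficitWall.Plane 4))
            * (C * (wallConst 4 L * (N : ℝ) ^ 2 * (Real.sqrt (gradConst 4 c) * dualC2 4 L + 2 * b ^ 2 * dualC1 4 L)))
          + 14 * Fintype.card (T4AveragingDeficitWall.Plane 4)
            * (C * (wallConst 4 L * (N : ℝ) ^ 2 * (Real.sqrt (gradConst 4 c) * dualC2 4 L + 2 * b ^ 2 * dualC1 4 L))) ^ 2)
        + Fintype.card (T4AveragingDeficitWall.Plane 4) * b ^ 2 := by
    have := wallConst_nonneg 4 L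
    have := dualC1_nonneg 4 L
    have := dualC2_nonneg 4 L
    have hwl : 0 ≤ wallConstLoc 4 L := by
      unfold T4AveragingDeficitNonAbelian.wallConstLoc
      have := T4AveragingDeficitNonAbelian.wallConstNA_nonneg (d := 4) L
      positivity
    positivity
  refine ⟨hθ0, ?_, ?_, ?_⟩
  · rw [inv_lt_one_iff₀]; right; linarith
  · exact actionRate_mono_rate hA (le_max_left _ _) hCA (by positivity) hθθ
  · exact hloc.mono (le_max_right _ _) hθ0 le_rfl hK

end

end Summit.QuantumFields.BalabanUV.T4Continuum.NE3LocalCrudeEnd
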